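import Summits.ABC.IUTFork.Repair.RHLevelMover
import HarnessLib

/-!
# D-0079 RESCUE sub-cell R-H — the level mover is TIGHT: Dupuy–Hilado's (Ind2) preserves every homothetic copy `c·log_p(𝒪_v^×)`,
# so NO (Ind2)-element carries a vector of `c·Λ` beyond norm `‖c‖·max‖Λ‖` (the reach attained by `RHLevelMover`, p461981)

PROOF-ONLY file (D-0012: 0 definitions, 0 `Prop` facts; abc-iut cell, rung LADDER-ABC:A2.RP → A2.RESCUE-H; seat abc-iut-rp-d3 gen 5, R-H prover
hand; ROUND-2 input for Q2/Q3 of the hull-reach family and for the barrier track). TAKES NO SIDE on [IUTchIII] Cor. 3.12 or on any author; OUR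
typed (Ind2) = Dupuy–Hilado's `Real.ismDH` = ALL bicontinuous `ℤ_p`-lattice automorphisms of the log-shell (STRONGER-THAN-PRINT); typed ≠ proved;
instantiated ≠ endorsed. Inputs BY NAME: abc-iut-w5-d180's dictionary `Thm311.Real.exists_basis_coe_logUnits_eq` /
`exists_mem_latticeAut_of_mem_ismDH` (`Thm311RealIsmDHMoverCriterion`: every element of `ismDH` IS a lattice automorphism of
`Λ = log_p(𝒪_v^×)` read on the rescaled completion), campaign-S's `PadicModule.image_smul_basisLattice_of_mem` (a lattice automorphism maps
`c·Λ` onto `c·Λ`, Weil BNT II §2 Th. 1).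

* `norm_ismDH_apply_le_of_mem_smul_logUnits` — `x ∈ c·Λ`, `g ∈ ismDH` ⟹ `‖g x‖ ≤ ‖c‖·R` for every bound `R` of `‖·‖` on `Λ`;
* `norm_ismDH_apply_le_of_zpow_smul_mem` — `p^k·x ∈ Λ` ⟹ `‖g x‖ ≤ p^k·R`;
* `norm_ism_apply_le_of_zpow_smul_mem_fibre` — the same at a fibre point `x | p` of a pilot datum (the presentation `φ_x` is the identity).
READING (neutral; with p461981 `RHLevelMover.exists_mover_of_not_mem_logUnits`): for a vector `s` on the EXACT level `k` of `Λ`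
(`p^k s ∈ Λ ∌ p^{k−1} s`) the (Ind2)-orbit of `s` reaches norm `p^k·max‖Λ‖` (the level mover) and NO further (this file): the pure-tensor
mover method's reach is EXACTLY the level reach, slot by slot. Hence the KEEP-slices signed in ROUND 1 for the hull-reach family (rows 15 / 8
/ 16 / 18 / 20: doors p462301, p463273, p464040, p460671, p465556–p466561) are the full extent of what PURE-TENSOR (Ind2)-movers give; any
wider sufficient clause must use the ADDITIVE SPAN of several images (row 4's exact threshold / lane U «ORBIT-SATURATION», abc-iut-rp-d1
`Cor312LicenceCellSpan`), not better movers. Nothing here bears on S_H itself (the hull may exceed every single image).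
[cite: WeilBNT1967, Ch. II §2, Th. 1] [cite: DupuyHilado2025, §4.9] [cite: Mochizuki2012, IUTchIV Prop. 1.2 (i) p. 10] [claim: Mochizuki2012, status: disputed]
-/

noncomputable section

open Set Function
open scoped Pointwise

namespace Summit.ABC.IUTFork.Repair.RHLevelMover

open Thm311 Thm311.Real Cor312 Cor312.Setting Cor312Vol Literature.IUT.LogThetaLattice Literature.IUT.LogVolume
open Literature.NumberTheory.NumberFields NumberField IsDedekindDomain Metric

section OnePlace

variable {F : Type} [Field F] [NumberField F] {p : ℕ} [hp : Fact p.Prime]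
  {logv : PadicLogs F} (hlog : LogvAnalyticAt p logv)
  (v : HeightOneSpectrum (𝓞 F)) (hv : ((p : ℕ) : 𝓞 F) ∈ v.asIdeal)

include hlog in
/-- **(Ind2) preserves the levels of `log_p(𝒪_v^×)`**: for `x ∈ c·Λ` and `g ∈ Real.ismDH logv v`, `g x ∈ c·Λ`, hence `‖g x‖ ≤ ‖c‖·R` for every
bound `R` of the norm on `Λ`. (Every `g ∈ ismDH` is a `ℤ_p`-lattice automorphism of `Λ`, abc-iut-w5-d180; a lattice automorphism maps `c·Λ`
onto itself.) [cite: WeilBNT1967, Ch. II §2, Th. 1] [cite: DupuyHilado2025, §4.9] -/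
theorem norm_ismDH_apply_le_of_mem_smul_logUnits {c : ℚ_[p]} {x : RescaledCompletion F p v hv}
    (hx : x ∈ c • (logUnits (RescaledCompletion F p v hv) : Set (RescaledCompletion F p v hv)))
    {g : Carrier (.inr v : Thm311.Real.Place F) ≃ₗ[ℚ] Carrier (.inr v : Thm311.Real.Place F)} (hg : g ∈ ismDH logv (.inr v))
    {R : ℝ} (hR : ∀ w ∈ (logUnits (RescaledCompletion F p v hv) : Set (RescaledCompletion F p v hv)), ‖w‖ ≤ R) :
    ‖toR p v hv (g (ofR p v hv x))‖ ≤ ‖c‖ * R := by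
  obtain ⟨n, hn, B, hΛ⟩ := exists_basis_coe_logUnits_eq (p := p) v hv
  obtain ⟨φ, hφ, hφg⟩ := exists_mem_latticeAut_of_mem_ismDH hlog B hΛ hg
  have himg : toR p v hv (g (ofR p v hv x)) ∈
      c • (logUnits (RescaledCompletion F p v hv) : Set (RescaledCompletion F p v hv)) := by
    rw [← hφg x, hΛ, ← PadicModule.image_smul_basisLattice_of_mem p B hφ c]
    rw [hΛ] at hx
    exact Set.mem_image_of_mem _ hx
  obtain ⟨w, hw, hwx⟩ := himg
  rw [← hwx, norm_smul]
  exact mul_le_mul_of_nonneg_left (hR w hw) (norm_nonneg c)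

include hlog in
/-- **… in `p`-level form**: `p^k·x ∈ Λ`, `g ∈ ismDH` ⟹ `‖g x‖ ≤ p^k·R` — the reach of the level mover of p461981 is the MAXIMUM over the
(Ind2)-orbit. [cite: WeilBNT1967, Ch. II §2, Th. 1] [cite: DupuyHilado2025, §4.9] -/
theorem norm_ismDH_apply_le_of_zpow_smul_mem {k : ℤ} {x : RescaledCompletion F p v hv}
    (hx : ((p : ℚ_[p]) ^ k) • x ∈ (logUnits (RescaledCompletion F p v hv) : Set (RescaledCompletion F p v hv)))
    {g : Carrier (.inr v : Thm311.Real.Place F) ≃ₗ[ℚ] Carrier (.inr v : Thm311.Real.Place F)} (hg : g ∈ ismDH logv (.inr v))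
    {R : ℝ} (hR : ∀ w ∈ (logUnits (RescaledCompletion F p v hv) : Set (RescaledCompletion F p v hv)), ‖w‖ ≤ R) :
    ‖toR p v hv (g (ofR p v hv x))‖ ≤ (p : ℝ) ^ k * R := by
  have hpQ : ((p : ℕ) : ℚ_[p]) ≠ 0 := Nat.cast_ne_zero.2 hp.out.ne_zero
  have hx' : x ∈ ((p : ℚ_[p]) ^ (-k)) • (logUnits (RescaledCompletion F p v hv) : Set (RescaledCompletion F p v hv)) :=
    ⟨((p : ℚ_[p]) ^ k) • x, hx, by
      simp only [smul_smul, ← zpow_add₀ hpQ, neg_add_cancel, zpow_zero, one_smul]⟩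
  have h := norm_ismDH_apply_le_of_mem_smul_logUnits hlog v hv hx' hg hR
  rwa [norm_zpow, Padic.norm_p, inv_zpow', neg_neg] at h

end OnePlace

/-! ## The fibre form -/

section Fibre

variable {F : Type} [Field F] [NumberField F] (X : PilotData F) {logv : PadicLogs F} (hlog : LogvAnalytic logv)

/-- **(Ind2) respects levels at a fibre point** (`kOf X p x` IS the rescaled completion; `φ_x` is the identity): `p^k·s ∈ log_p(𝒪_x^×)` and
`g ∈ Ism_x` ⟹ `‖g s‖ ≤ p^k·R` for every bound `R` of the norm on `log_p(𝒪_x^×)`. [cite: WeilBNT1967, Ch. II §2, Th. 1] [cite: DupuyHilado2025, §4.9] -/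
theorem norm_ism_apply_le_of_zpow_smul_mem_fibre (pp : Nat.Primes) (x : (thetaIndex X).Fibre (.inr pp)) {k : ℤ}
    {s : haveI : Fact (pp : ℕ).Prime := ⟨pp.2⟩; kOf X pp.1 x}
    (hs : haveI : Fact (pp : ℕ).Prime := ⟨pp.2⟩;
      (((pp : ℕ) : ℚ_[pp]) ^ k) • s ∈ (logUnits (kOf X pp.1 x) : Set (kOf X pp.1 x)))
    {g : (logShellsDH X logv).carrier x.1 ≃ₗ[ℚ] (logShellsDH X logv).carrier x.1} (hg : g ∈ (logShellsDH X logv).ism x.1)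
    {R : ℝ} (hR : haveI : Fact (pp : ℕ).Prime := ⟨pp.2⟩; ∀ w ∈ (logUnits (kOf X pp.1 x) : Set (kOf X pp.1 x)), ‖w‖ ≤ R) :
    haveI : Fact (pp : ℕ).Prime := ⟨pp.2⟩
    ‖(presAt X hlog pp).φ x (g (((presAt X hlog pp).φ x).symm s))‖ ≤ ((pp : ℕ) : ℝ) ^ k * R := by
  haveI : Fact (pp : ℕ).Prime := ⟨pp.2⟩
  obtain ⟨x1, hx⟩ := x
  rcases x1 with w | v
  · exact absurd hx (by simp [thetaIndex])
  · exact norm_ismDH_apply_le_of_zpow_smul_mem (hlog pp) v (natCast_mem_placeOf X pp.1 ⟨.inr v, hx⟩) hs hg hR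

end Fibre

end Summit.ABC.IUTFork.Repair.RHLevelMover

end
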